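import Summits.HodgeConjecture.HodgeConjecture.Theorems.HeckePrymWeilWeilTwelvefoldsSqrtMinus7CmEndomorphismOfMulMem
import HarnessLib

/-!
# The CM curves `ℂ/(ℤ + ℤ√-d)` with `[√-d]` as `AbelianVariety ℂ` endomorphisms, for every `d ≥ 1`

Crux `WeilTwelvefoldsSqrtMinus7` (stmt-HodgeConjecture-1261), line `amnesic-secant-sheaves-split-fourteenfolds`
(lead seat c1), registered sub-goal `exists_cmCurveSqrt`: for every `d ≥ 1`, with `w = i√d` and the period pair
`L = (1, w)` (lattice `Λ = ℤ + ℤ√-d`, `wΛ ⊆ Λ`), the abelian variety `E_Λ` carries an endomorphism `ι` with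
`ι ≫ ι = -d` acting on complex points as `π(z) ↦ π(wz)` — the CM elliptic curve with `[√-d]` as a morphism of
`ℂ`-group schemes, for EVERY imaginary quadratic order `ℤ[√-d]` (the object the aiming lemma of the product trick,
`Motives.exists_cmWeilSurface_aimedSplitProduct_of_ne_one_of_ne_three`, needs for each `d`). From
`exists_endomorphism_of_mul_mem_lattice` and faithfulness of `ℂ`-points.

## References
* D. A. Cox, *Primes of the form x² + ny²*, 2nd ed. (2013), §14.B, Prop. 14.9. [Cox2013]
* J. H. Silverman, *Advanced Topics in the Arithmetic of Elliptic Curves* (1994), Prop. II.2.3.1 (iii).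
-/

noncomputable section

set_option linter.dupNamespace false

open CategoryTheory AlgebraicGeometry Polynomial MonoidalCategory CartesianMonoidalCategory
open scoped Polynomial.Bivariate
open Literature.AlgebraicGeometry Literature.AlgebraicGeometry.Motives

namespace Summit.HodgeConjecture.HodgeConjecture.Theorems.WeilTwelvefoldsSqrtMinus7.AmnesicSecantSheaves

/-- `1` and a non-real complex number are `ℝ`-linearly independent (copy of the lemma of `…CmCurveAction`, kept
here so that the two files are independent). [folklore] -/
theorem linearIndependent_one_of_im_ne_zero' {w : ℂ} (hw : w.im ≠ 0) : LinearIndependent ℝ ![(1 : ℂ), w] := by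
  refine LinearIndependent.pair_iff.mpr fun s t hst => ?_
  have him := congrArg Complex.im hst
  simp only [Complex.add_im, Complex.smul_im, Complex.one_im, mul_zero, zero_add, smul_eq_mul,
    Complex.zero_im] at him
  have ht : t = 0 := (mul_eq_zero.mp him).resolve_right hw
  have hre := congrArg Complex.re hst
  simp only [ht, zero_smul, add_zero, Complex.smul_re, Complex.one_re, smul_eq_mul, mul_one,
    Complex.zero_re] at hre
  exact ⟨hre, ht⟩

section
open scoped MonObj

/-- **The CM curve `ℂ/(ℤ + ℤ√-d)` with `[√-d]` as an `AbelianVariety ℂ` endomorphism, `d ≥ 1`.** With `w = i√d`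
(`w² = -d`) and the period pair `L = (1, w)`, there is an endomorphism `φ₀` of the abelian variety `E_Λ`
(`WeierstrassCurve.abelianVarietyOfAddHom` of `L.curve`) with `φ₀ ≫ φ₀ = -d·𝟙` whose action on complex points is
`π(z) ↦ π(wz)`; `(ω₁, ω₂) = (1, w)` and the matrix of `w` on it is `N = (0 1; -d 0)` (all recorded in the statement). From
`exists_endomorphism_of_mul_mem_lattice` (every multiplier of `Λ` is an endomorphism) and faithfulness of
`ℂ`-points. [cite: SilvermanAEC2009, Thm. VI.4.1 (b)] [cite: Milne1986AbelianVarieties, §3 Thm. 3.1] -/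
theorem exists_cmCurveSqrt (d : ℕ) (hd : 0 < d) :
    ∃ (L : PeriodPair) (w : ℂ) (N : Matrix (Fin 2) (Fin 2) ℤ) (φ₀ : (L.curve.abelianVarietyOfAddHom L.curve.addHom L.curve.negHom L.curve.lift_pointEquiv_comp_addHom
          L.curve.pointEquiv_comp_negHom_geom) ⟶
        (L.curve.abelianVarietyOfAddHom L.curve.addHom L.curve.negHom L.curve.lift_pointEquiv_comp_addHom
          L.curve.pointEquiv_comp_negHom_geom)),
      w * w = -(d : ℂ) ∧ L.ω₁ = 1 ∧ L.ω₂ = w ∧ N = !![0, 1; -(d : ℤ), 0] ∧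
      (w * L.ω₁ = (N 0 0 : ℂ) * L.ω₁ + (N 0 1 : ℂ) * L.ω₂) ∧
      (w * L.ω₂ = (N 1 0 : ℂ) * L.ω₁ + (N 1 1 : ℂ) * L.ω₂) ∧
      φ₀ ≫ φ₀ = -((d : ℤ) • 𝟙 (L.curve.abelianVarietyOfAddHom L.curve.addHom L.curve.negHom L.curve.lift_pointEquiv_comp_addHom
          L.curve.pointEquiv_comp_negHom_geom)) ∧
      ∀ z : ℂ, L.upoint z ≫ φ₀.hom.hom.hom = L.upoint (w * z) := by
  -- the multiplier `w = i√d` and the lattice `Λ = ℤ + ℤw`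
  set w : ℂ := Complex.I * (Real.sqrt d : ℂ) with hwdef
  have hw2' : w * w = -(d : ℂ) := by
    have h7 : ((Real.sqrt d : ℝ) : ℂ) ^ 2 = d := by
      rw [← Complex.ofReal_pow, Real.sq_sqrt (by positivity : (0 : ℝ) ≤ d)]; norm_num
    rw [hwdef]
    linear_combination (Real.sqrt d : ℂ) ^ 2 * Complex.I_sq - h7
  have hwim : w.im ≠ 0 := by
    rw [hwdef]
    simp only [Complex.mul_im, Complex.I_re, Complex.ofReal_im, mul_zero, Complex.I_im, Complex.ofReal_re,
      one_mul, zero_add]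
    have : (0 : ℝ) < d := by exact_mod_cast hd
    positivity
  have hw0 : w ≠ 0 := fun h => hwim (by rw [h, Complex.zero_im])
  clear_value w
  let L : PeriodPair := ⟨1, w, linearIndependent_one_of_im_ne_zero' hwim⟩
  have hL1 : L.ω₁ = 1 := rfl
  have hL2 : L.ω₂ = w := rfl
  set E : AbelianVariety ℂ := L.curve.abelianVarietyOfAddHom L.curve.addHom L.curve.negHom
    L.curve.lift_pointEquiv_comp_addHom L.curve.pointEquiv_comp_negHom_geom with hE
  -- `wΛ ⊆ Λ`: `w(m + nw) = -dn + mw`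
  have hwΛ : ∀ l ∈ L.lattice, w * l ∈ L.lattice := by
    intro l hl
    obtain ⟨m, n, rfl⟩ := PeriodPair.mem_lattice.mp hl
    refine PeriodPair.mem_lattice.mpr ⟨-(d : ℤ) * n, m, ?_⟩
    rw [hL1, hL2]
    push_cast
    linear_combination (-(n : ℂ)) * hw2'
  -- the endomorphism
  obtain ⟨φ, hφ⟩ := exists_endomorphism_of_mul_mem_lattice L hw0 hwΛ
  refine ⟨L, w, !![0, 1; -(d : ℤ), 0], φ, hw2', hL1, hL2, rfl, ?_, ?_, ?_, hφ⟩
  · rw [hL1, hL2]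
    simp only [Matrix.of_apply, Matrix.cons_val', Matrix.cons_val_zero, Matrix.cons_val_one,
      Matrix.cons_val_fin_one]
    push_cast
    ring
  · rw [hL1, hL2]
    simp only [Matrix.of_apply, Matrix.cons_val', Matrix.cons_val_zero, Matrix.cons_val_one,
      Matrix.cons_val_fin_one]
    push_cast
    linear_combination hw2'
  -- `φ ≫ φ = -d` on `ℂ`-points, hence as morphisms
  apply AbelianVariety.hom_ext
  haveI : IsReduced E.X.left := AbelianVariety.isReduced_left E
  refine SchemeOver.hom_ext_of_forall_algPoints ℂ fun p => ?_
  obtain ⟨z, rfl⟩ := L.upoint_surjective p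
  letI instGrp : GrpObj L.curve.scheme := E.grpObj
  let φ' : L.curve.scheme ⟶ L.curve.scheme := φ.hom.hom.hom
  have hφ' : ∀ z : ℂ, L.upoint z ≫ φ' = L.upoint (w * z) := hφ
  have lhs : L.upoint z ≫ (φ ≫ φ).hom.hom.hom = L.upoint (w * (w * z)) := by
    change (L.upoint z ≫ φ') ≫ φ' = _
    rw [hφ', hφ']
  let pe : L.curve.toAffine.Point ≃ AlgPoints L.curve.scheme ℂ := L.curve.pointEquiv (L := ℂ)
  have hupt : ∀ z : ℂ, L.upoint z = pe (L.toPoint z) := fun z => rfl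
  have hmul : ∀ x y : L.curve.toAffine.Point, pe (x + y) = pe x * pe y := by
    intro x y
    change L.curve.pointEquiv (x + y) = lift (L.curve.pointEquiv x) (L.curve.pointEquiv y) ≫ L.curve.addHom
    exact (L.curve.lift_pointEquiv_comp_addHom_of_field (L := ℂ) x y).symm
  let peHom : L.curve.toAffine.Point →+ Additive (AlgPoints L.curve.scheme ℂ) :=
    { toFun := fun x => Additive.ofMul (pe x)
      map_zero' := by
        have e := hmul 0 0
        rw [add_zero] at e
        have e' : pe 0 * pe 0 = pe 0 * 1 := by rw [mul_one]; exact e.symm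
        exact congrArg Additive.ofMul (mul_left_cancel e')
      map_add' := fun x y => by
        change Additive.ofMul (pe (x + y)) = Additive.ofMul (pe x) + Additive.ofMul (pe y)
        rw [hmul]; rfl }
  have h1pt : pe 0 = 1 := by
    have e := hmul 0 0
    rw [add_zero] at e
    have e' : pe 0 * pe 0 = pe 0 * 1 := by rw [mul_one]; exact e.symm
    exact mul_left_cancel e'
  -- points of `k • 𝟙 E`: `π(z) ↦ π(kz)`
  let uk : ℕ → (L.curve.scheme ⟶ L.curve.scheme) := fun k => (k • 𝟙 E : E ⟶ E).hom.hom.hom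
  have hnsmul : ∀ k : ℕ, L.upoint z ≫ uk k = L.upoint ((k : ℂ) * z) := by
    intro k
    induction k with
    | zero =>
      change L.upoint z ≫ ((0 • 𝟙 E : E ⟶ E)).hom.hom.hom = _
      rw [zero_nsmul]
      change L.upoint z ≫ (1 : L.curve.scheme ⟶ L.curve.scheme) = _
      rw [MonObj.comp_one, Nat.cast_zero, zero_mul, hupt 0, PeriodPair.toPoint_zero, h1pt]
    | succ k ih =>
      change L.upoint z ≫ (((k + 1) • 𝟙 E : E ⟶ E)).hom.hom.hom = _
      rw [succ_nsmul]
      change L.upoint z ≫ (uk k * (𝟙 L.curve.scheme : L.curve.scheme ⟶ L.curve.scheme)) = _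
      rw [MonObj.comp_mul, ih, Category.comp_id, hupt, hupt, ← hmul, hupt,
        ← PeriodPair.toPointHom_apply L.toPoint_add_holds, ← PeriodPair.toPointHom_apply L.toPoint_add_holds,
        ← PeriodPair.toPointHom_apply L.toPoint_add_holds, ← map_add]
      congr 2
      push_cast
      ring
  have rhs : L.upoint z ≫ (-((d : ℤ) • 𝟙 E)).hom.hom.hom = L.upoint (-(d : ℂ) * z) := by
    rw [natCast_zsmul]
    change L.upoint z ≫ (uk d)⁻¹ = _
    rw [GrpObj.comp_inv, hnsmul, hupt, hupt, neg_mul, ← PeriodPair.toPointHom_apply L.toPoint_add_holds,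
      ← PeriodPair.toPointHom_apply L.toPoint_add_holds, map_neg]
    exact (congrArg Additive.toMul (map_neg peHom _)).symm
  change L.upoint z ≫ (φ ≫ φ).hom.hom.hom = L.upoint z ≫ (-((d : ℤ) • 𝟙 E)).hom.hom.hom
  rw [lhs, rhs, ← mul_assoc, hw2']

end

end Summit.HodgeConjecture.HodgeConjecture.Theorems.WeilTwelvefoldsSqrtMinus7.AmnesicSecantSheaves

end
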